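import Summits.AnomalousDissipation.AnomalousDissipation.Theorems.MarginalStabilityChainStretchedVortexRowsStubLogPotentialEnergy
import Summits.AnomalousDissipation.AnomalousDissipation.Theorems.MarginalStabilityChainStretchedVortexRowsStubLogPotentialGain
import Literature.Analysis.FluidPDE.GaussianVortexKernelRadial
import Literature.Analysis.FluidPDE.PlanarPolarCoords

/-!
# Tools for stub `stub_arnoldHighModes` (crux `CoreLinearInvertibility`,
# stmt-NavierStokesRegularity-17973, route `FilamentSkeletonRss`, line `Sketch`) — part A:
# the logarithmic energy identity for a CONTINUOUS neutral Gaussian-bounded density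

For a continuous density `g` on `ℝ² = EuclideanSpace ℝ (Fin 2)` with `|g(η)| ≤ B e^{−‖η‖²/8}` and
`∫ g = 0`, and its logarithmic potential `ψ = N ∗ g`, `N = (2π)⁻¹ log ‖·‖`:

* `ψ ∈ C¹` with `∇ψ(ξ) = ∫ g(η) DN(ξ − η) dη` — the derivative is GAINED from the kernel for a
  merely measurable bounded density (landed `logPotential_gain`), so no differentiability of `g`
  is needed anywhere below;
* the weak Poisson equation `∫ ⟪∇ψ, ∇φ⟫ = −∫ g φ` for `φ ∈ C¹_c` (Fubini and the gradient-form
  Green identity `∫ ⟪DN(ξ − η), ∇φ(ξ)⟫ dξ = −φ(η)`, landed `integral_gradLogKernel_inner_gradient`);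
* neutrality ⇒ `‖∇ψ(ξ)‖ ≤ C/(1 + ‖ξ‖)²` (landed `norm_gradLogConv_le`), hence `‖∇ψ‖² ∈ L¹`;
  `ψ g ∈ L¹`;
* **the energy identity `∫ ‖∇ψ‖² = −∫ ψ g`** by the cut-off argument of the landed
  `integral_norm_gradient_sq_eq` (which is stated for `C¹` densities): test the weak equation
  against `χ_n ψ` and pass to the limit by dominated convergence.

Everything is adapted from `…StubLogPotentialGreen` / `…StubLogPotentialEnergy` (AnomalousDissipation
toolkit), with the `C¹` gradient formula replaced by the gained one.

References: Th. Gallay, V. Šverák, arXiv:2110.13739, §2 (2.6)–(2.8) (the energy of an `X₀`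
density); folklore potential theory.
-/

set_option linter.dupNamespace false

noncomputable section

namespace Summit.NavierStokesRegularity.NavierStokesRegularity.Theorems

open Set Function Filter MeasureTheory Topology Metric WithLp
open Literature.Analysis.FluidPDE
open Summit.AnomalousDissipation.AnomalousDissipation.Theorems.MarginalStabilityChainStretchedVortexRows
open scoped InnerProductSpace RealInnerProductSpace

/-- **The weak Poisson equation for the logarithmic potential of a CONTINUOUS Gaussian-bounded
density**: `∫ ⟪∇ψ, ∇φ⟫ = −∫ g φ` for every `φ ∈ C¹_c(ℝ²)` (gained gradient formula, Fubini, and the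
gradient-form Green identity). [folklore] -/
theorem highModes_weak_poisson {B : ℝ} {g : EuclideanSpace ℝ (Fin 2) → ℝ} (hgc : Continuous g)
    (hg0 : ∀ η, |g η| ≤ B * Real.exp (-(1 / 8) * ‖η‖ ^ 2))
    {φ : EuclideanSpace ℝ (Fin 2) → ℝ} (hφ : ContDiff ℝ 1 φ) (hφc : HasCompactSupport φ) :
    ∫ ξ, ⟪gradient (fun ξ : EuclideanSpace ℝ (Fin 2) => ∫ η, (2 * Real.pi)⁻¹ * Real.log ‖ξ - η‖ * g η) ξ,
        gradient φ ξ⟫ = -∫ η, g η * φ η := by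
  -- adapted from `integral_inner_gradient_logPotential_gradient` (AnomalousDissipation toolkit)
  have hgrad := (logPotential_gain B g hgc.measurable hg0).2.1
  have hφg : Continuous (gradient φ) :=
    (InnerProductSpace.toDual ℝ (EuclideanSpace ℝ (Fin 2))).symm.continuous.comp (hφ.continuous_fderiv one_ne_zero)
  -- Step 1: the pairing as an iterated integral
  have h1 : ∀ ξ, ⟪gradient (fun ξ : EuclideanSpace ℝ (Fin 2) => ∫ η, (2 * Real.pi)⁻¹ * Real.log ‖ξ - η‖ * g η) ξ,
      gradient φ ξ⟫ = ∫ η, g η * ((2 * Real.pi * ‖ξ - η‖ ^ 2)⁻¹ * ⟪gradient φ ξ, ξ - η⟫) := by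
    intro ξ
    obtain ⟨hint, hgr⟩ := hgrad ξ
    rw [hgr, real_inner_comm, ← integral_inner hint]
    refine integral_congr_ae (Eventually.of_forall fun η => ?_)
    simp only [real_inner_smul_right]
  simp_rw [h1]
  -- Step 2: Fubini
  set F : EuclideanSpace ℝ (Fin 2) → EuclideanSpace ℝ (Fin 2) → ℝ := fun ξ η =>
    g η * ((2 * Real.pi * ‖ξ - η‖ ^ 2)⁻¹ * ⟪gradient φ ξ, ξ - η⟫) with hF
  have hFmeas : Measurable (uncurry F) := by
    refine (hgc.measurable.comp measurable_snd).mul ((Measurable.inv ?_).mul ?_)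
    · exact measurable_const.mul ((measurable_fst.sub measurable_snd).norm.pow_const 2)
    · exact ((hφg.comp continuous_fst).inner (continuous_fst.sub continuous_snd)).measurable
  have hFm : AEStronglyMeasurable (uncurry F)
      ((volume : Measure (EuclideanSpace ℝ (Fin 2))).prod (volume : Measure (EuclideanSpace ℝ (Fin 2)))) :=
    hFmeas.aestronglyMeasurable
  have hnormF : ∀ ξ η, ‖F ξ η‖ ≤ ‖g η • ((2 * Real.pi * ‖ξ - η‖ ^ 2)⁻¹ • (ξ - η))‖ * ‖gradient φ ξ‖ := by
    intro ξ η
    simp only [hF, norm_mul, norm_smul]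
    have := abs_real_inner_le_norm (gradient φ ξ) (ξ - η)
    rw [Real.norm_eq_abs, Real.norm_eq_abs, Real.norm_eq_abs]
    calc |g η| * (|(2 * Real.pi * ‖ξ - η‖ ^ 2)⁻¹| * |⟪gradient φ ξ, ξ - η⟫|)
        ≤ |g η| * (|(2 * Real.pi * ‖ξ - η‖ ^ 2)⁻¹| * (‖gradient φ ξ‖ * ‖ξ - η‖)) := by gcongr
      _ = _ := by ring
  have hrow : ∀ ξ, Integrable (F ξ) := fun ξ =>
    (((integrable_smul_gradLogKernel hgc hg0 ξ).norm.mul_const ‖gradient φ ξ‖)).mono'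
      (hFmeas.comp (measurable_const.prodMk measurable_id)).aestronglyMeasurable
      (Eventually.of_forall (hnormF ξ))
  obtain ⟨M, hM⟩ := exists_integral_norm_smul_gradLogKernel_le hg0 hgc
  have hgradc : HasCompactSupport (gradient φ) :=
    (hφc.fderiv (𝕜 := ℝ)).comp_left
      (g := fun L => (InnerProductSpace.toDual ℝ (EuclideanSpace ℝ (Fin 2))).symm L) (map_zero _)
  have hbd : Integrable fun ξ : EuclideanSpace ℝ (Fin 2) => M * ‖gradient φ ξ‖ :=
    (hφg.norm.integrable_of_hasCompactSupport hgradc.norm).const_mul M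
  have hrowbd : ∀ ξ, ∫ η, ‖F ξ η‖ ≤ M * ‖gradient φ ξ‖ := by
    intro ξ
    calc ∫ η, ‖F ξ η‖ ≤ ∫ η, ‖g η • ((2 * Real.pi * ‖ξ - η‖ ^ 2)⁻¹ • (ξ - η))‖ * ‖gradient φ ξ‖ :=
          integral_mono (hrow ξ).norm
            ((integrable_smul_gradLogKernel hgc hg0 ξ).norm.mul_const _) (hnormF ξ)
      _ = (∫ η, ‖g η • ((2 * Real.pi * ‖ξ - η‖ ^ 2)⁻¹ • (ξ - η))‖) * ‖gradient φ ξ‖ := integral_mul_const _ _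
      _ ≤ M * ‖gradient φ ξ‖ := mul_le_mul_of_nonneg_right (hM ξ) (norm_nonneg _)
  have hGi : Integrable (uncurry F)
      ((volume : Measure (EuclideanSpace ℝ (Fin 2))).prod (volume : Measure (EuclideanSpace ℝ (Fin 2)))) := by
    rw [integrable_prod_iff hFm]
    refine ⟨Eventually.of_forall hrow, hbd.mono' hFm.norm.integral_prod_right' (Eventually.of_forall fun ξ => ?_)⟩
    rw [Real.norm_of_nonneg (integral_nonneg fun η => norm_nonneg _)]
    exact hrowbd ξ
  rw [integral_integral_swap hGi]
  -- Step 3: the inner integral is `−g(η) φ(η)` by the Green identity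
  have h3 : ∀ η, ∫ ξ, F ξ η = -(g η * φ η) := fun η => by
    simp only [hF]
    rw [integral_const_mul, integral_gradLogKernel_inner_gradient hφ hφc η]
    ring
  simp_rw [h3]
  rw [integral_neg]

/-- `ψ ∈ C¹` and `∇ψ` is continuous (derivative gained from the kernel). [folklore] -/
theorem highModes_contDiff_and_continuous_gradient {B : ℝ} {g : EuclideanSpace ℝ (Fin 2) → ℝ} (hgc : Continuous g)
    (hg0 : ∀ η, |g η| ≤ B * Real.exp (-(1 / 8) * ‖η‖ ^ 2))
    {ψ : EuclideanSpace ℝ (Fin 2) → ℝ}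
    (hψ : ψ = fun ξ : EuclideanSpace ℝ (Fin 2) => ∫ η, (2 * Real.pi)⁻¹ * Real.log ‖ξ - η‖ * g η) :
    ContDiff ℝ 1 ψ ∧ Continuous (gradient ψ) := by
  have hC1 : ContDiff ℝ 1 ψ := by rw [hψ]; exact (logPotential_gain B g hgc.measurable hg0).1
  exact ⟨hC1, (InnerProductSpace.toDual ℝ (EuclideanSpace ℝ (Fin 2))).symm.continuous.comp
    (hC1.continuous_fderiv one_ne_zero)⟩

/-- **Gradient decay from neutrality**: `‖∇ψ(ξ)‖ ≤ C/(1 + ‖ξ‖)²`. [folklore] -/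
theorem highModes_gradient_decay {B : ℝ} {g : EuclideanSpace ℝ (Fin 2) → ℝ} (hgc : Continuous g)
    (hg0 : ∀ η, |g η| ≤ B * Real.exp (-(1 / 8) * ‖η‖ ^ 2)) (hneutral : ∫ η, g η = 0)
    {ψ : EuclideanSpace ℝ (Fin 2) → ℝ}
    (hψ : ψ = fun ξ : EuclideanSpace ℝ (Fin 2) => ∫ η, (2 * Real.pi)⁻¹ * Real.log ‖ξ - η‖ * g η) :
    ∃ C : ℝ, ∀ ξ, ‖gradient ψ ξ‖ ≤ C / (1 + ‖ξ‖) ^ 2 := by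
  obtain ⟨C, hC⟩ := norm_gradLogConv_le hgc hg0 hneutral
  refine ⟨C, fun ξ => ?_⟩
  rw [hψ, ((logPotential_gain B g hgc.measurable hg0).2.1 ξ).2]
  exact hC ξ

/-- **`‖∇ψ‖² ∈ L¹(ℝ²)`** for a neutral density (`‖∇ψ‖ ≤ C/(1+‖ξ‖)²`). [folklore] -/
theorem highModes_integrable_norm_gradient_sq {B : ℝ} {g : EuclideanSpace ℝ (Fin 2) → ℝ} (hgc : Continuous g)
    (hg0 : ∀ η, |g η| ≤ B * Real.exp (-(1 / 8) * ‖η‖ ^ 2)) (hneutral : ∫ η, g η = 0)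
    {ψ : EuclideanSpace ℝ (Fin 2) → ℝ}
    (hψ : ψ = fun ξ : EuclideanSpace ℝ (Fin 2) => ∫ η, (2 * Real.pi)⁻¹ * Real.log ‖ξ - η‖ * g η) :
    Integrable fun ξ => ‖gradient ψ ξ‖ ^ 2 := by
  -- adapted from `integrable_norm_gradient_sq` (AnomalousDissipation toolkit)
  obtain ⟨Cg, hCg⟩ := highModes_gradient_decay hgc hg0 hneutral hψ
  obtain ⟨-, hgradc⟩ := highModes_contDiff_and_continuous_gradient hgc hg0 hψ
  have hJ : Integrable fun x : EuclideanSpace ℝ (Fin 2) => (1 + ‖x‖) ^ (-(4:ℝ)) :=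
    integrable_one_add_norm (by rw [finrank_euclideanSpace_fin]; norm_num)
  refine (hJ.const_mul (Cg ^ 2)).mono' (hgradc.norm.pow 2).aestronglyMeasurable (Eventually.of_forall fun ξ => ?_)
  rw [Real.norm_of_nonneg (sq_nonneg _)]
  have hpos : 0 < 1 + ‖ξ‖ := by positivity
  have h4 : (1 + ‖ξ‖) ^ (-(4:ℝ)) = ((1 + ‖ξ‖) ^ 4)⁻¹ := by
    rw [Real.rpow_neg hpos.le, ← Real.rpow_natCast]; norm_num
  rw [h4]
  calc ‖gradient ψ ξ‖ ^ 2 ≤ (Cg / (1 + ‖ξ‖) ^ 2) ^ 2 := pow_le_pow_left₀ (norm_nonneg _) (hCg ξ) 2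
    _ = Cg ^ 2 * ((1 + ‖ξ‖) ^ 4)⁻¹ := by field_simp

/-- **`ψ g ∈ L¹(ℝ²)`** (`|ψ| ≤ C(1 + log(1+‖ξ‖)) ≤ C(1+‖ξ‖)`, `|g| ≤ B e^{−‖ξ‖²/8}`). [folklore] -/
theorem highModes_integrable_logPotential_mul {B : ℝ} {g : EuclideanSpace ℝ (Fin 2) → ℝ} (hgc : Continuous g)
    (hg0 : ∀ η, |g η| ≤ B * Real.exp (-(1 / 8) * ‖η‖ ^ 2))
    {ψ : EuclideanSpace ℝ (Fin 2) → ℝ}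
    (hψ : ψ = fun ξ : EuclideanSpace ℝ (Fin 2) => ∫ η, (2 * Real.pi)⁻¹ * Real.log ‖ξ - η‖ * g η) :
    Integrable fun ξ => ψ ξ * g ξ := by
  -- adapted from `integrable_logPotential_mul` (AnomalousDissipation toolkit)
  obtain ⟨Cψ, hCψ0, hCψ⟩ : ∃ C : ℝ, 0 ≤ C ∧ ∀ ξ, |ψ ξ| ≤ C * (1 + Real.log (1 + ‖ξ‖)) := by
    rw [hψ]; exact abs_logPotential_le hg0
  obtain ⟨hC1, -⟩ := highModes_contDiff_and_continuous_gradient hgc hg0 hψ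
  refine ((integrable_one_add_norm_pow_mul_exp_eighth 1).const_mul (Cψ * B)).mono'
    (hC1.continuous.mul hgc).aestronglyMeasurable (Eventually.of_forall fun ξ => ?_)
  rw [Real.norm_eq_abs, abs_mul]
  have hlog : Real.log (1 + ‖ξ‖) ≤ ‖ξ‖ := by
    have := Real.log_le_sub_one_of_pos (by positivity : (0:ℝ) < 1 + ‖ξ‖); linarith
  have hL : 0 ≤ Real.log (1 + ‖ξ‖) := Real.log_nonneg (by linarith [norm_nonneg ξ])
  calc |ψ ξ| * |g ξ| ≤ Cψ * (1 + Real.log (1 + ‖ξ‖)) * (B * Real.exp (-(1 / 8) * ‖ξ‖ ^ 2)) :=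
        mul_le_mul (hCψ ξ) (hg0 ξ) (abs_nonneg _) (by positivity)
    _ ≤ Cψ * (1 + ‖ξ‖) ^ 1 * (B * Real.exp (-(1 / 8) * ‖ξ‖ ^ 2)) := by
        gcongr
        · exact (abs_nonneg _).trans (hg0 ξ)
        · rw [pow_one]; linarith
    _ = Cψ * B * ((1 + ‖ξ‖) ^ 1 * Real.exp (-(1 / 8) * ‖ξ‖ ^ 2)) := by ring

/-- **The energy identity `∫ ‖∇ψ‖² = −∫ ψ g`** for a CONTINUOUS neutral Gaussian-bounded density
(cut-off argument on the weak Poisson equation). [folklore] -/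
theorem highModes_integral_norm_gradient_sq_eq {B : ℝ} {g : EuclideanSpace ℝ (Fin 2) → ℝ} (hgc : Continuous g)
    (hg0 : ∀ η, |g η| ≤ B * Real.exp (-(1 / 8) * ‖η‖ ^ 2)) (hneutral : ∫ η, g η = 0)
    {ψ : EuclideanSpace ℝ (Fin 2) → ℝ}
    (hψ : ψ = fun ξ : EuclideanSpace ℝ (Fin 2) => ∫ η, (2 * Real.pi)⁻¹ * Real.log ‖ξ - η‖ * g η) :
    ∫ ξ, ‖gradient ψ ξ‖ ^ 2 = -∫ ξ, ψ ξ * g ξ := by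
  -- adapted from `integral_norm_gradient_sq_eq` (AnomalousDissipation toolkit)
  obtain ⟨hC1, hgradc⟩ := highModes_contDiff_and_continuous_gradient hgc hg0 hψ
  have hψd : Differentiable ℝ ψ := hC1.differentiable one_ne_zero
  obtain ⟨Cψ, hCψ0, hCψ⟩ : ∃ C : ℝ, 0 ≤ C ∧ ∀ ξ, |ψ ξ| ≤ C * (1 + Real.log (1 + ‖ξ‖)) := by
    rw [hψ]; exact abs_logPotential_le hg0
  obtain ⟨Cg, hCg⟩ := highModes_gradient_decay hgc hg0 hneutral hψ
  have hCg0 : 0 ≤ Cg := by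
    have h := (norm_nonneg _).trans (hCg 0)
    simpa using h
  have hweak : ∀ φ : EuclideanSpace ℝ (Fin 2) → ℝ, ContDiff ℝ 1 φ → HasCompactSupport φ →
      ∫ ξ, ⟪gradient ψ ξ, gradient φ ξ⟫ = -∫ η, g η * φ η := by
    rw [hψ]; exact fun φ hφ hφc => highModes_weak_poisson hgc hg0 hφ hφc
  have hI1 := highModes_integrable_norm_gradient_sq hgc hg0 hneutral hψ
  have hI2 := highModes_integrable_logPotential_mul hgc hg0 hψ
  have hgi : ∀ (f : EuclideanSpace ℝ (Fin 2) → ℝ) (ξ v : EuclideanSpace ℝ (Fin 2)),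
      fderiv ℝ f ξ v = ⟪gradient f ξ, v⟫ := fun f ξ v => by
    rw [gradient, InnerProductSpace.toDual_symm_apply]
  -- the cut-offs `c n = χ(·/(n+1))`
  obtain ⟨χ, M, hχ, hχc, h1, h0, h01, hM⟩ := exists_bump
  have hM0 : 0 ≤ M := (norm_nonneg _).trans (hM 0)
  have hRn : ∀ n : ℕ, (1:ℝ) ≤ (n:ℝ) + 1 := fun n => by
    have := n.cast_nonneg (α := ℝ); linarith
  obtain ⟨c, hc⟩ : ∃ c : ℕ → EuclideanSpace ℝ (Fin 2) → ℝ,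
      c = fun (n : ℕ) (x : EuclideanSpace ℝ (Fin 2)) => χ ((((n:ℝ) + 1)⁻¹) • x) := ⟨_, rfl⟩
  have hcp : ∀ n : ℕ, ContDiff ℝ 1 (c n) ∧ HasCompactSupport (c n) ∧
      (∀ x, ‖x‖ < (n:ℝ) + 1 → c n x = 1) ∧ (∀ x, ‖x‖ < (n:ℝ) + 1 → fderiv ℝ (c n) x = 0) ∧
      ∀ x, ‖fderiv ℝ (c n) x‖ ≤ 4 * M / (1 + ‖x‖) := by
    intro n
    have e : c n = fun x : EuclideanSpace ℝ (Fin 2) => χ ((((n:ℝ) + 1)⁻¹) • x) := by rw [hc]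
    rw [e]
    exact scaledCutoff_props hχ hχc h1 h0 hM (hRn n)
  have hc01 : ∀ n x, 0 ≤ c n x ∧ c n x ≤ 1 := fun n x => by rw [hc]; exact h01 _
  -- eventually `‖ξ‖ < n + 1`
  have hev : ∀ ξ : EuclideanSpace ℝ (Fin 2), ∀ᶠ n : ℕ in atTop, ‖ξ‖ < (n:ℝ) + 1 := fun ξ => by
    refine (eventually_ge_atTop ⌈‖ξ‖⌉₊).mono fun n hn => ?_
    have h1 := Nat.le_ceil ‖ξ‖
    have h2 : (⌈‖ξ‖⌉₊ : ℝ) ≤ n := Nat.cast_le.2 hn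
    linarith
  -- the dominating function of the error term
  have hJ : Integrable fun x : EuclideanSpace ℝ (Fin 2) => (8 * M * Cψ * Cg) * (1 + ‖x‖) ^ (-(5 / 2 : ℝ)) :=
    (integrable_one_add_norm (by rw [finrank_euclideanSpace_fin]; norm_num)).const_mul _
  have hEbd : ∀ n ξ, ‖ψ ξ * ⟪gradient (c n) ξ, gradient ψ ξ⟫‖ ≤ (8 * M * Cψ * Cg) * (1 + ‖ξ‖) ^ (-(5 / 2 : ℝ)) := by
    intro n ξ
    rw [norm_mul, Real.norm_eq_abs]
    have hin := abs_real_inner_le_norm (gradient (c n) ξ) (gradient ψ ξ)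
    have hgn : ‖gradient (c n) ξ‖ ≤ 4 * M / (1 + ‖ξ‖) := by
      rw [gradient, LinearIsometryEquiv.norm_map]; exact (hcp n).2.2.2.2 ξ
    have hL : 0 ≤ 1 + Real.log (1 + ‖ξ‖) := by
      have := Real.log_nonneg (by linarith [norm_nonneg ξ] : (1:ℝ) ≤ 1 + ‖ξ‖); linarith
    have hw := log_weight_le_rpow ξ
    have hpos : 0 < 1 + ‖ξ‖ := by positivity
    calc |ψ ξ| * ‖⟪gradient (c n) ξ, gradient ψ ξ⟫‖
        ≤ (Cψ * (1 + Real.log (1 + ‖ξ‖))) * ((4 * M / (1 + ‖ξ‖)) * (Cg / (1 + ‖ξ‖) ^ 2)) := by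
          refine mul_le_mul (hCψ ξ) (hin.trans (mul_le_mul hgn (hCg ξ) (norm_nonneg _) (by positivity)))
            (norm_nonneg _) (by positivity)
      _ = (4 * M * Cψ * Cg) * ((1 + Real.log (1 + ‖ξ‖)) * ((1 + ‖ξ‖)⁻¹ * ((1 + ‖ξ‖) ^ 2)⁻¹)) := by
          field_simp
      _ ≤ (4 * M * Cψ * Cg) * (2 * (1 + ‖ξ‖) ^ (-(5 / 2 : ℝ))) :=
          mul_le_mul_of_nonneg_left hw (by positivity)
      _ = _ := by ring
  have hEm : ∀ n, AEStronglyMeasurable (fun ξ => ψ ξ * ⟪gradient (c n) ξ, gradient ψ ξ⟫) volume := by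
    intro n
    have hgc' : Continuous (gradient (c n)) :=
      (InnerProductSpace.toDual ℝ (EuclideanSpace ℝ (Fin 2))).symm.continuous.comp
        ((hcp n).1.continuous_fderiv one_ne_zero)
    exact (hC1.continuous.mul (hgc'.inner hgradc)).aestronglyMeasurable
  have hiE : ∀ n, Integrable fun ξ => ψ ξ * ⟪gradient (c n) ξ, gradient ψ ξ⟫ := fun n =>
    hJ.mono' (hEm n) (Eventually.of_forall (hEbd n))
  have hiA : ∀ n, Integrable fun ξ => c n ξ * ‖gradient ψ ξ‖ ^ 2 := fun n =>
    hI1.mono' (((hcp n).1.continuous.mul (hgradc.norm.pow 2)).aestronglyMeasurable)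
      (Eventually.of_forall fun ξ => by
        rw [norm_mul, Real.norm_eq_abs, abs_of_nonneg (hc01 n ξ).1, Real.norm_of_nonneg (sq_nonneg _)]
        exact mul_le_of_le_one_left (sq_nonneg _) (hc01 n ξ).2)
  -- the identity for every `n`
  have hid : ∀ n : ℕ, (∫ ξ, c n ξ * ‖gradient ψ ξ‖ ^ 2) + ∫ ξ, ψ ξ * ⟪gradient (c n) ξ, gradient ψ ξ⟫ =
      -∫ ξ, g ξ * (c n ξ * ψ ξ) := by
    intro n
    have hφd : ContDiff ℝ 1 (fun x => c n x * ψ x) := (hcp n).1.mul hC1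
    have hφc : HasCompactSupport (fun x => c n x * ψ x) := (hcp n).2.1.mul_right
    have hpt : ∀ ξ, ⟪gradient ψ ξ, gradient (fun x => c n x * ψ x) ξ⟫ =
        c n ξ * ‖gradient ψ ξ‖ ^ 2 + ψ ξ * ⟪gradient (c n) ξ, gradient ψ ξ⟫ := by
      intro ξ
      rw [real_inner_comm, ← hgi, fderiv_fun_mul (((hcp n).1.differentiable one_ne_zero) ξ) (hψd ξ),
        _root_.add_apply, FunLike.coe_smul, FunLike.coe_smul, Pi.smul_apply, Pi.smul_apply, smul_eq_mul,
        smul_eq_mul, hgi ψ, hgi (c n), real_inner_self_eq_norm_sq]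
    rw [← integral_add (hiA n) (hiE n), ← hweak _ hφd hφc]
    exact integral_congr_ae (Eventually.of_forall fun ξ => (hpt ξ).symm)
  -- the three limits
  have hA : Tendsto (fun n : ℕ => ∫ ξ, c n ξ * ‖gradient ψ ξ‖ ^ 2) atTop (𝓝 (∫ ξ, ‖gradient ψ ξ‖ ^ 2)) := by
    refine tendsto_integral_of_dominated_convergence (fun ξ => ‖gradient ψ ξ‖ ^ 2)
      (fun n => ((hcp n).1.continuous.mul (hgradc.norm.pow 2)).aestronglyMeasurable) hI1
      (fun n => Eventually.of_forall fun ξ => ?_) (Eventually.of_forall fun ξ => ?_)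
    · rw [norm_mul, Real.norm_eq_abs, abs_of_nonneg (hc01 n ξ).1, Real.norm_of_nonneg (sq_nonneg _)]
      exact mul_le_of_le_one_left (sq_nonneg _) (hc01 n ξ).2
    · refine tendsto_const_nhds.congr' ?_
      filter_upwards [hev ξ] with n hn
      rw [(hcp n).2.2.1 ξ hn, one_mul]
  have hG : Tendsto (fun n : ℕ => ∫ ξ, g ξ * (c n ξ * ψ ξ)) atTop (𝓝 (∫ ξ, ψ ξ * g ξ)) := by
    refine tendsto_integral_of_dominated_convergence (fun ξ => ‖ψ ξ * g ξ‖)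
      (fun n => (hgc.mul ((hcp n).1.continuous.mul hC1.continuous)).aestronglyMeasurable) hI2.norm
      (fun n => Eventually.of_forall fun ξ => ?_) (Eventually.of_forall fun ξ => ?_)
    · rw [norm_mul, norm_mul, norm_mul, Real.norm_eq_abs (c n ξ), abs_of_nonneg (hc01 n ξ).1]
      calc ‖g ξ‖ * (c n ξ * ‖ψ ξ‖) ≤ ‖g ξ‖ * (1 * ‖ψ ξ‖) := by gcongr; exact (hc01 n ξ).2
        _ = ‖ψ ξ‖ * ‖g ξ‖ := by ring
    · refine tendsto_const_nhds.congr' ?_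
      filter_upwards [hev ξ] with n hn
      rw [(hcp n).2.2.1 ξ hn, one_mul, mul_comm]
  have hE : Tendsto (fun n : ℕ => ∫ ξ, ψ ξ * ⟪gradient (c n) ξ, gradient ψ ξ⟫) atTop (𝓝 0) := by
    have h := tendsto_integral_of_dominated_convergence (fun ξ => (8 * M * Cψ * Cg) * (1 + ‖ξ‖) ^ (-(5 / 2 : ℝ)))
      hEm hJ (fun n => Eventually.of_forall (hEbd n))
      (Eventually.of_forall fun ξ => (?_ :
        Tendsto (fun n : ℕ => ψ ξ * ⟪gradient (c n) ξ, gradient ψ ξ⟫) atTop (𝓝 0)))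
    · simpa using h
    · refine tendsto_const_nhds.congr' ?_
      filter_upwards [hev ξ] with n hn
      rw [gradient, (hcp n).2.2.2.1 ξ hn, map_zero, inner_zero_left, mul_zero]
  have hlim1 := hA.add hE
  have hlim2 : Tendsto (fun n : ℕ => (∫ ξ, c n ξ * ‖gradient ψ ξ‖ ^ 2) +
      ∫ ξ, ψ ξ * ⟪gradient (c n) ξ, gradient ψ ξ⟫) atTop (𝓝 (-(∫ ξ, ψ ξ * g ξ))) := by
    simp_rw [hid]
    exact hG.neg
  have := tendsto_nhds_unique hlim1 hlim2
  rwa [add_zero] at this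


/-! ### The registered tools stub -/

/-- **Registered tools stub `stub_arnoldHighModesToolsA`** (helpers for `stub_arnoldHighModes`, line
`Sketch` of crux `CoreLinearInvertibility`, stmt-NavierStokesRegularity-17973): for a CONTINUOUS
density `g` with `|g| ≤ B e^{−‖η‖²/8}` and `∫ g = 0`, the logarithmic potential `ψ = N ∗ g`
(`N = (2π)⁻¹ log ‖·‖`) is `C¹` with `‖∇ψ(ξ)‖ ≤ C/(1+‖ξ‖)²`, `‖∇ψ‖² ∈ L¹`, `ψ g ∈ L¹`, and
`∫ ‖∇ψ‖² = −∫ ψ g`. [folklore] -/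
theorem stub_arnoldHighModesToolsA :
    ∀ (B : ℝ) (g : EuclideanSpace ℝ (Fin 2) → ℝ), Continuous g →
      (∀ η, |g η| ≤ B * Real.exp (-(1 / 8) * ‖η‖ ^ 2)) → (∫ η, g η = 0) →
      ∀ ψ : EuclideanSpace ℝ (Fin 2) → ℝ,
        ψ = (fun ξ : EuclideanSpace ℝ (Fin 2) => ∫ η, (2 * Real.pi)⁻¹ * Real.log ‖ξ - η‖ * g η) →
        ContDiff ℝ 1 ψ ∧ (∃ C : ℝ, ∀ ξ, ‖gradient ψ ξ‖ ≤ C / (1 + ‖ξ‖) ^ 2) ∧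
        Integrable (fun ξ => ‖gradient ψ ξ‖ ^ 2) ∧ Integrable (fun ξ => ψ ξ * g ξ) ∧
          ∫ ξ, ‖gradient ψ ξ‖ ^ 2 = -∫ ξ, ψ ξ * g ξ :=
  fun _ _ hgc hg0 hneutral _ hψ =>
    ⟨(highModes_contDiff_and_continuous_gradient hgc hg0 hψ).1, highModes_gradient_decay hgc hg0 hneutral hψ,
      highModes_integrable_norm_gradient_sq hgc hg0 hneutral hψ,
      highModes_integrable_logPotential_mul hgc hg0 hψ,
      highModes_integral_norm_gradient_sq_eq hgc hg0 hneutral hψ⟩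

end Summit.NavierStokesRegularity.NavierStokesRegularity.Theorems
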